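import Summits.AtomisticToContinuum.HydrodynamicLimit.Theorems.AntiMazurCoboundariesKineticFluxLdDecaySelfTiltObjects
import Literature.Analysis.FluidPDE.HardSphereTiltWeight
import HarnessLib

/-!
# The quadratic (`β = 0`) shadow of the self-tilted identity (stub `stub_quadraticShadow`)

Crux `Summit.AtomisticToContinuum.HydrodynamicLimit.Theses.AntiMazurCoboundaries.KineticFluxLdDecay`
(stmt-AtomisticToContinuum-10967), line `self-tilted-edge-covariance`, registered stub
`stub_quadraticShadow : QuadraticShadow` (objects module
`…Theorems.AntiMazurCoboundariesKineticFluxLdDecaySelfTiltObjects`).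

For a hard-sphere flow `Φ` on `𝕋³`, a `Φ`-invariant probability law `μ` carried by the good set, a bounded
MEASURABLE observable `F` and a window `h > 0`, with `J_h(z) = ∫₀ʰ F(Φ_r z) dr` and the stationary
autocorrelation `R(u) = E_μ[F∘Φ_u · F]`:

* `integral_pathInt_sq` — `E_μ J_h² = 2 ∫₀ʰ ∫₀ˢ R(u) du ds`. Proof WITHOUT a Fubini on the triangle:
  `J_h² = ∫₀ʰ J_h · F∘Φ_s ds` (a constant times an integral), one Fubini swap, and for each `s` the shift
  `J_h = (∫_{-s}^{h-s} F∘Φ_r dr)∘Φ_s` on good orbits (group law) plus invariance of `μ` give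
  `E_μ[J_h · F∘Φ_s] = ∫_{-s}^{h-s} R = ∫₀ˢ R + ∫₀^{h-s} R` (`R` is even, again by invariance); finally
  `∫₀ʰ (∫₀^{h-s} R) ds = ∫₀ʰ (∫₀ˢ R) ds` by `s ↦ h − s`.
* `fejerInt_zero` — at `β = 0` the tilt weight is `1`, so `𝒞₀(u) = R(u) − (E_μF)²` and
  `I_0(h) = ∫₀ʰ∫₀ˢ R − h²(E_μF)²/2`.
* `stub_quadraticShadow` — the registered statement, `E_μ (h⁻¹J_h)² = 2h⁻² I_0(h) + (E_μF)²` in the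
  `∫⁻ … ofReal` currency.
-/

noncomputable section

open MeasureTheory Set Filter Topology
open scoped ENNReal

namespace Summit.AtomisticToContinuum.HydrodynamicLimit.Theorems.SelfTilt

open Literature.Analysis.FluidPDE (HardSphereFlow Config)

variable {ε : ℝ} {n : ℕ}

/-! ## The stationary autocorrelation `R(u) = E_μ[F∘Φ_u · F]` -/

/-- `(z, r) ↦ F(Φ_r z) · F(z)` is a.e.-measurable on `phase space × time` for every law carried by the good
set and every s-finite measure on the time axis. -/
private theorem aemeasurable_corrIntegrand (Φ : TFlow ε n) {μ : Measure (TPhase n)}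
    (hgood : μ Φ.goodᶜ = 0) (ν : Measure ℝ) [SFinite ν] {F : TPhase n → ℝ} (hF : Measurable F) :
    AEMeasurable (fun p : TPhase n × ℝ => F (Φ.flow p.2 p.1) * F p.1) (μ.prod ν) :=
  (Φ.aemeasurable_comp_flow_prod_torus hgood ν (0 : ℝ) hF).mul (hF.comp measurable_fst).aemeasurable

/-- The stationary autocorrelation `r ↦ E_μ[F∘Φ_r · F]` is a.e.-strongly measurable in the lag (Fubini
measurability from the joint a.e.-measurability of the flow). -/
private theorem aestronglyMeasurable_corr (Φ : TFlow ε n) {μ : Measure (TPhase n)} [IsFiniteMeasure μ]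
    (hgood : μ Φ.goodᶜ = 0) {F : TPhase n → ℝ} (hF : Measurable F) :
    AEStronglyMeasurable (fun r => ∫ z, F (Φ.flow r z) * F z ∂μ) volume := by
  have h1 : AEStronglyMeasurable (fun p : ℝ × TPhase n => F (Φ.flow p.1 p.2) * F p.2) (volume.prod μ) :=
    (aemeasurable_corrIntegrand Φ hgood volume hF).prod_swap.aestronglyMeasurable
  exact h1.integral_prod_right'

/-- `|E_μ[F∘Φ_r · F]| ≤ C²` for `|F| ≤ C` and a probability law `μ`. -/
private theorem abs_corr_le (Φ : TFlow ε n) (μ : Measure (TPhase n)) [IsProbabilityMeasure μ]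
    {F : TPhase n → ℝ} {C : ℝ} (hC : ∀ z, |F z| ≤ C) (r : ℝ) :
    |∫ z, F (Φ.flow r z) * F z ∂μ| ≤ C * C := by
  have hb := norm_integral_le_of_norm_le_const (μ := μ) (f := fun z => F (Φ.flow r z) * F z)
    (C := C * C) (ae_of_all _ fun z => by
      rw [Real.norm_eq_abs, abs_mul]
      exact mul_le_mul (hC _) (hC z) (abs_nonneg _) ((abs_nonneg _).trans (hC (Φ.flow r z))))
  simpa only [Real.norm_eq_abs, probReal_univ, mul_one] using hb

/-- The stationary autocorrelation is interval integrable on every interval. -/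
private theorem intervalIntegrable_corr (Φ : TFlow ε n) (μ : Measure (TPhase n)) [IsProbabilityMeasure μ]
    (hgood : μ Φ.goodᶜ = 0) {F : TPhase n → ℝ} (hF : Measurable F) {C : ℝ} (hC : ∀ z, |F z| ≤ C)
    (a b : ℝ) : IntervalIntegrable (fun r => ∫ z, F (Φ.flow r z) * F z ∂μ) volume a b :=
  (intervalIntegrable_const (c := C * C)).mono_fun' (aestronglyMeasurable_corr Φ hgood hF).restrict
    (ae_of_all _ fun r => by simpa only [Real.norm_eq_abs] using abs_corr_le Φ μ hC r)

/-- The stationary autocorrelation is even: `E_μ[F∘Φ_{-u} · F] = E_μ[F∘Φ_u · F]` (invariance of `μ` under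
`Φ_u` and the group law on the good set). -/
private theorem corr_neg (Φ : TFlow ε n) (μ : Measure (TPhase n))
    (hinv : ∀ t, MeasurePreserving (Φ.flow t) μ μ) (hgood : μ Φ.goodᶜ = 0) {F : TPhase n → ℝ}
    (hF : Measurable F) (u : ℝ) :
    ∫ z, F (Φ.flow (-u) z) * F z ∂μ = ∫ z, F (Φ.flow u z) * F z ∂μ := by
  have hGm : Measurable fun w => F (Φ.flow (-u) w) * F w := (hF.comp (Φ.measurable_flow _)).mul hF
  have h := integral_map (μ := μ) (hinv u).measurable.aemeasurable
    (f := fun w => F (Φ.flow (-u) w) * F w) hGm.aestronglyMeasurable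
  rw [(hinv u).map_eq] at h
  rw [h]
  refine integral_congr_ae ?_
  filter_upwards [(mem_ae_iff.2 hgood : ∀ᵐ z ∂μ, z ∈ Φ.good)] with z hz
  rw [← Φ.flow_add (-u) u z hz, neg_add_cancel, Φ.flow_zero z hz, mul_comm]

/-! ## The shift: `E_μ[J_h · F∘Φ_s] = ∫_{-s}^{h-s} R` -/

/-- For every `s`, `E_μ[J_h · F∘Φ_s] = ∫_{-s}^{h-s} E_μ[F∘Φ_r · F] dr`: on good orbits
`J_h(z) = ∫_{-s}^{h-s} F(Φ_r (Φ_s z)) dr` (group law), invariance of `μ` under `Φ_s`, and Fubini. -/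
private theorem integral_pathInt_mul_comp_flow (Φ : TFlow ε n) (μ : Measure (TPhase n))
    [IsProbabilityMeasure μ] (hinv : ∀ t, MeasurePreserving (Φ.flow t) μ μ) (hgood : μ Φ.goodᶜ = 0)
    {F : TPhase n → ℝ} (hF : Measurable F) {C : ℝ} (hC : ∀ z, |F z| ≤ C) {h : ℝ} (hh : 0 ≤ h)
    (s : ℝ) :
    ∫ z, pathInt Φ F h z * F (Φ.flow s z) ∂μ =
      ∫ r in (-s)..(h - s), ∫ z, F (Φ.flow r z) * F z ∂μ := by
  have hae : ∀ᵐ z ∂μ, z ∈ Φ.good := mem_ae_iff.2 hgood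
  -- (i) shift along the orbit and invariance
  have hg : AEStronglyMeasurable (fun w => (∫ r in (-s)..(h - s), F (Φ.flow r w)) * F w) μ :=
    ((Φ.aemeasurable_intervalIntegral_comp_flow_torus hF (-s) (h - s) hgood).mul
      hF.aemeasurable).aestronglyMeasurable
  have h1 : ∫ z, pathInt Φ F h z * F (Φ.flow s z) ∂μ =
      ∫ z, (fun w => (∫ r in (-s)..(h - s), F (Φ.flow r w)) * F w) (Φ.flow s z) ∂μ := by
    refine integral_congr_ae ?_
    filter_upwards [hae] with z hz
    show pathInt Φ F h z * F (Φ.flow s z) = (∫ r in (-s)..(h - s), F (Φ.flow r (Φ.flow s z))) * F (Φ.flow s z)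
    rw [Φ.intervalIntegral_comp_flow_flow F hz (-s) (h - s) s, neg_add_cancel, sub_add_cancel]
  have h2 := integral_map (hinv s).measurable.aemeasurable
    (f := fun w => (∫ r in (-s)..(h - s), F (Φ.flow r w)) * F w) (by rw [(hinv s).map_eq]; exact hg)
  rw [(hinv s).map_eq] at h2
  rw [h1, ← h2]
  -- (ii) Fubini over `μ × [-s, h - s]`
  have hsh : -s ≤ h - s := by linarith
  have hpt : ∀ w, (∫ r in (-s)..(h - s), F (Φ.flow r w)) * F w =
      ∫ r in Ioc (-s) (h - s), F (Φ.flow r w) * F w := fun w => by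
    rw [← intervalIntegral.integral_mul_const, intervalIntegral.integral_of_le hsh]
  simp_rw [hpt]
  rw [intervalIntegral.integral_of_le hsh]
  have hint : Integrable (Function.uncurry fun (w : TPhase n) (r : ℝ) => F (Φ.flow r w) * F w)
      (μ.prod (volume.restrict (Ioc (-s) (h - s)))) := by
    refine Integrable.of_bound
      (aemeasurable_corrIntegrand Φ hgood _ hF).aestronglyMeasurable (C * C) (ae_of_all _ fun p => ?_)
    rw [Function.uncurry_def, Real.norm_eq_abs, abs_mul]
    exact mul_le_mul (hC _) (hC p.1) (abs_nonneg _) ((abs_nonneg _).trans (hC (Φ.flow p.2 p.1)))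
  exact integral_integral_swap hint

/-! ## The quadratic identity `E_μ J_h² = 2 ∫₀ʰ ∫₀ˢ R` -/

/-- **`E_μ J_h² = 2 ∫₀ʰ ∫₀ˢ E_μ[F∘Φ_u · F] du ds`** for a bounded measurable `F`, a `Φ`-invariant
probability law `μ` carried by the good set and `h ≥ 0`. -/
theorem integral_pathInt_sq (Φ : TFlow ε n) (μ : Measure (TPhase n)) [IsProbabilityMeasure μ]
    (hinv : ∀ t, MeasurePreserving (Φ.flow t) μ μ) (hgood : μ Φ.goodᶜ = 0)
    {F : TPhase n → ℝ} (hF : Measurable F) {C : ℝ} (hC : ∀ z, |F z| ≤ C) {h : ℝ} (hh : 0 ≤ h) :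
    ∫ z, pathInt Φ F h z ^ 2 ∂μ =
      2 * ∫ s in (0 : ℝ)..h, ∫ u in (0 : ℝ)..s, ∫ z, F (Φ.flow u z) * F z ∂μ := by
  obtain ⟨R, hR⟩ : ∃ R : ℝ → ℝ, ∀ u, R u = ∫ z, F (Φ.flow u z) * F z ∂μ := ⟨_, fun _ => rfl⟩
  have hRfun : (fun u => ∫ z, F (Φ.flow u z) * F z ∂μ) = R := funext fun u => (hR u).symm
  have hRi : ∀ a b, IntervalIntegrable R volume a b := fun a b => by
    rw [← hRfun]
    exact intervalIntegrable_corr Φ μ hgood hF hC a b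
  simp only [← hR]
  -- step 1: `J_h² = ∫₀ʰ J_h · F∘Φ_s ds` pathwise, then Fubini over `μ × [0, h]`
  have h1 : ∫ z, pathInt Φ F h z ^ 2 ∂μ =
      ∫ s in (0 : ℝ)..h, ∫ z, pathInt Φ F h z * F (Φ.flow s z) ∂μ := by
    have e : ∀ z, pathInt Φ F h z ^ 2 = ∫ s in Ioc (0 : ℝ) h, pathInt Φ F h z * F (Φ.flow s z) := by
      intro z
      rw [sq, ← intervalIntegral.integral_of_le hh, intervalIntegral.integral_const_mul]
    simp_rw [e]
    rw [intervalIntegral.integral_of_le hh]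
    have hint : Integrable (Function.uncurry fun (z : TPhase n) (s : ℝ) => pathInt Φ F h z * F (Φ.flow s z))
        (μ.prod (volume.restrict (Ioc (0 : ℝ) h))) := by
      refine Integrable.of_bound
        (((aemeasurable_pathInt Φ hgood hF h).comp_fst).mul
          (Φ.aemeasurable_comp_flow_prod_torus hgood _ (0 : ℝ) hF)).aestronglyMeasurable
        (|h| * C * C) (ae_of_all _ fun p => ?_)
      rw [Function.uncurry_def, Real.norm_eq_abs, abs_mul]
      exact mul_le_mul (abs_pathInt_le Φ hC h _) (hC _) (abs_nonneg _)
        (mul_nonneg (abs_nonneg _) ((abs_nonneg _).trans (hC p.1)))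
    exact integral_integral_swap hint
  -- step 2: for each `s`, `E_μ[J_h · F∘Φ_s] = ∫₀ˢ R + ∫₀^{h-s} R`
  have h2 : ∀ s, ∫ z, pathInt Φ F h z * F (Φ.flow s z) ∂μ =
      (∫ u in (0 : ℝ)..s, R u) + ∫ u in (0 : ℝ)..(h - s), R u := by
    intro s
    rw [integral_pathInt_mul_comp_flow Φ μ hinv hgood hF hC hh s, hRfun,
      ← intervalIntegral.integral_add_adjacent_intervals (hRi (-s) 0) (hRi 0 (h - s))]
    congr 1
    have e : ∫ u in (0 : ℝ)..s, R u = ∫ u in (0 : ℝ)..s, R (-u) := by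
      refine intervalIntegral.integral_congr fun u _ => ?_
      rw [hR, hR]
      exact (corr_neg Φ μ hinv hgood hF u).symm
    rw [e, intervalIntegral.integral_comp_neg, neg_zero]
  simp_rw [h1, h2]
  -- step 3: `∫₀ʰ (∫₀^{h-s} R) ds = ∫₀ʰ (∫₀ˢ R) ds`
  have hA : Continuous fun s => ∫ u in (0 : ℝ)..s, R u := intervalIntegral.continuous_primitive hRi 0
  have hB : Continuous fun s => ∫ u in (0 : ℝ)..(h - s), R u := hA.comp (continuous_const.sub continuous_id)
  rw [intervalIntegral.integral_add (hA.intervalIntegrable 0 h) (hB.intervalIntegrable 0 h), two_mul]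
  congr 1
  have := intervalIntegral.integral_comp_sub_left (fun s => ∫ u in (0 : ℝ)..s, R u) h (a := 0) (b := h)
  simpa only [sub_self, sub_zero] using this

/-! ## The Fejér integral at `β = 0` -/

/-- At `β = 0` the edge covariance is the stationary autocovariance:
`𝒞₀(u) = E_μ[F∘Φ_u · F] − (E_μ F)²` (the tilt weight is `1`; `E_μ[F∘Φ_u] = E_μ F` by invariance). -/
theorem edgeCov_zero (Φ : TFlow ε n) (μ : Measure (TPhase n)) [IsProbabilityMeasure μ]
    (hinv : ∀ t, MeasurePreserving (Φ.flow t) μ μ) {F : TPhase n → ℝ} (hF : Measurable F) (u : ℝ) :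
    edgeCov Φ μ F 0 u = (∫ z, F (Φ.flow u z) * F z ∂μ) - (∫ z, F z ∂μ) * ∫ z, F z ∂μ := by
  have h := integral_map (μ := μ) (hinv u).measurable.aemeasurable (f := F) hF.aestronglyMeasurable
  rw [(hinv u).map_eq] at h
  simp only [edgeCov, tiltMean_zero, ← h]

/-- **The Fejér integral at `β = 0`**: `I_0(h) = ∫₀ʰ∫₀ˢ E_μ[F∘Φ_u · F] du ds − h² (E_μF)² / 2`. -/
theorem fejerInt_zero (Φ : TFlow ε n) (μ : Measure (TPhase n)) [IsProbabilityMeasure μ]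
    (hinv : ∀ t, MeasurePreserving (Φ.flow t) μ μ) (hgood : μ Φ.goodᶜ = 0)
    {F : TPhase n → ℝ} (hF : Measurable F) {C : ℝ} (hC : ∀ z, |F z| ≤ C) (h : ℝ) :
    fejerInt Φ μ F 0 h =
      (∫ s in (0 : ℝ)..h, ∫ u in (0 : ℝ)..s, ∫ z, F (Φ.flow u z) * F z ∂μ) -
        h ^ 2 / 2 * (∫ z, F z ∂μ) ^ 2 := by
  obtain ⟨R, hR⟩ : ∃ R : ℝ → ℝ, ∀ u, R u = ∫ z, F (Φ.flow u z) * F z ∂μ := ⟨_, fun _ => rfl⟩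
  have hRfun : (fun u => ∫ z, F (Φ.flow u z) * F z ∂μ) = R := funext fun u => (hR u).symm
  have hRi : ∀ a b, IntervalIntegrable R volume a b := fun a b => by
    rw [← hRfun]
    exact intervalIntegrable_corr Φ μ hgood hF hC a b
  set m : ℝ := ∫ z, F z ∂μ with hm
  have hcov : (edgeCov Φ μ F 0) = fun u => R u - m * m := by
    funext u
    rw [edgeCov_zero Φ μ hinv hF u, hR]
  simp only [fejerInt, hcov, ← hR]
  have hin : ∀ s, ∫ u in (0 : ℝ)..s, (R u - m * m) = (∫ u in (0 : ℝ)..s, R u) - s * (m * m) := by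
    intro s
    rw [intervalIntegral.integral_sub (hRi 0 s) intervalIntegrable_const, intervalIntegral.integral_const,
      sub_zero, smul_eq_mul]
  simp_rw [hin]
  have hA : Continuous fun s => ∫ u in (0 : ℝ)..s, R u := intervalIntegral.continuous_primitive hRi 0
  have hB : Continuous fun s : ℝ => s * (m * m) := continuous_id.mul continuous_const
  rw [intervalIntegral.integral_sub (hA.intervalIntegrable 0 h) (hB.intervalIntegrable 0 h),
    intervalIntegral.integral_mul_const, integral_id]
  ring

/-! ## The registered stub -/

/-- **Registered stub `stub_quadraticShadow` — the quadratic (`β = 0`) shadow of the self-tilted identity.**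
For every hard-sphere flow `Φ` on `𝕋³`, every `Φ`-invariant probability law `μ` carried by the good set, every
bounded measurable `F` and `h > 0`:
`∫⁻ ofReal ((h⁻¹ J_h)²) dμ = ofReal (2 h⁻² I_0(h) + (E_μ F)²)`, i.e.
`E_μ (h⁻¹J_h)² = 2h⁻² ∫₀ʰ∫₀ˢ Cov_μ(F∘Φ_u, F) du ds + (E_μ F)²` (`integral_pathInt_sq`,
`fejerInt_zero`, `ofReal_integral_eq_lintegral_ofReal`). -/
theorem stub_quadraticShadow : QuadraticShadow := by
  intro ε n Φ μ hμ hinv hgood F hFm hFb h hh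
  obtain ⟨C, hC⟩ := hFb
  -- the integrand is bounded (by `C²`) and a.e.-measurable, hence integrable
  have hJm : AEMeasurable (fun z => (h⁻¹ * pathInt Φ F h z) ^ 2) μ :=
    ((aemeasurable_pathInt Φ hgood hFm h).const_mul h⁻¹).pow_const 2
  have hbound : ∀ z, |(h⁻¹ * pathInt Φ F h z) ^ 2| ≤ C ^ 2 := fun z => by
    rw [abs_pow, abs_mul, abs_inv, abs_of_pos hh]
    refine pow_le_pow_left₀ (mul_nonneg (inv_nonneg.2 hh.le) (abs_nonneg _)) ?_ 2
    have h1 := abs_pathInt_le Φ hC h z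
    rw [abs_of_pos hh] at h1
    calc h⁻¹ * |pathInt Φ F h z| ≤ h⁻¹ * (h * C) := mul_le_mul_of_nonneg_left h1 (inv_nonneg.2 hh.le)
      _ = C := by field_simp
  have hint : Integrable (fun z => (h⁻¹ * pathInt Φ F h z) ^ 2) μ :=
    Integrable.of_bound hJm.aestronglyMeasurable (C ^ 2) (ae_of_all _ fun z => by
      rw [Real.norm_eq_abs]
      exact hbound z)
  rw [← ofReal_integral_eq_lintegral_ofReal hint (ae_of_all _ fun z => sq_nonneg _)]
  congr 1
  have e1 : ∫ z, (h⁻¹ * pathInt Φ F h z) ^ 2 ∂μ = h⁻¹ ^ 2 * ∫ z, pathInt Φ F h z ^ 2 ∂μ := by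
    rw [← integral_const_mul]
    exact integral_congr_ae (ae_of_all _ fun z => by ring)
  rw [e1, integral_pathInt_sq Φ μ hinv hgood hFm hC hh.le, fejerInt_zero Φ μ hinv hgood hFm hC h]
  field_simp
  ring

end Summit.AtomisticToContinuum.HydrodynamicLimit.Theorems.SelfTilt

end
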